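import Mathlib.Probability.Martingale.Basic
import Literature.Probability.Percolation.CardyFormula
import Literature.Probability.RandomPlanarGeometry.SLECardyFlow
import Literature.Probability.RandomPlanarGeometry.SLERealFlowIto
import Literature.Probability.RandomPlanarGeometry.CardyFunctionIncBeta
import Literature.Probability.Process.ContinuousHitting
import Literature.Probability.Process.LevyCharacterisation
import HarnessLib

/-!
# Vocabulary of line `crossing_martingale` for crux `CardyRigidity` (stmt-CriticalPhenomena-0746)

Sub-problem `CriticalPhenomena/CardyFormulaZ2`; crux
`Summit.CriticalPhenomena.CardyFormulaZ2.Theses.CardyUniqueLimit.CardyRigidity` (the same `Prop` in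
all nine route files that want the item: `∀ f, (∀ R, R.HasCrossingLimit (bondDomainCrossingProb R) f)
→ EqOn f cardyFunction (Ioo 0 1)`).  This file is the **definitions module** of the checked skeleton
`Cruxes/CardyRigidity/Lines/crossing_martingale.lean` (strategist
`planner-cstrat-stmt-CriticalPhenomena-0746-b1-0`, `ledger skeleton check` OK, sha `b6f6c48c78f9`,
4 registered stubs `stub_crossingMartingale` / `stub_kernelFacts` / `stub_betaPinning` /
`stub_kernelAffineBeta`; lead `prover-line-stmt-CriticalPhenomena-0746-0`): it carries, verbatim and
sorry-free, the skeleton's §0 VOCABULARY — the all-rectangle hypothesis `AllRectangleKernel`, the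
normalised incomplete beta law `betaLaw a` (Cardy's `F` is `betaLaw (2/3)`), the frozen real Loewner
flows `markFlow` of three boundary marks on one side of the tip of a driving process `W`, their
cross-ratio process `etaProc`, the level stopping time `levelTime`, the level-stopped one-sided
crossing observable `crossingObs f W x m M d`, admissible marks/levels `AdmissibleLevels`, the
regularity predicate `IsRegularDriver` (the clauses of the tree's FK-Ising layer-4 fact
`LatticeModels.exists_observableMartingale_fkInterface`) and the crossing-martingale property
`IsCrossingMartingaleFamily` — and §1 the elementary LEMMAS the composition and the stub files share
(the stopped moduli live in `(0,1)`, transfer of the observable along an identity of kernels, affine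
change of kernel, `betaLaw (2/3) = incBeta13 / incBeta13 1` and its boundary values).  The stub helper
files `Theorems/CardyUniqueLimitCardyRigidity<StubName>.lean` (each proving
`theorem <stubName> : <registered signature>` by name, `--supports stmt-CriticalPhenomena-0746`) and the
closing skeleton file import this module so that they share ONE copy of every object; the namespace is
the skeleton's.  Nothing here is asserted: every `def … : Prop` is a predicate with parameters.

References: Werner (2007) §3 (the one-sided cross-ratio `η_t`), Lawler (2005) §4.1 (real Loewner
flow), Kemppainen–Smirnov (2017) Thm 1.3 / Prop. 3.8 (regularity of the driving process of
subsequential interface limits), Cardy (1992) eq. (8) (the beta law).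
-/

noncomputable section

open MeasureTheory Filter Set Topology
open scoped NNReal ENNReal
open Literature.Probability.RandomPlanarGeometry
open Literature.Probability.Percolation (bondDomainCrossingProb)
open Literature.Probability.Process (exitTime coe_untopA_min_le)

namespace Summit.CriticalPhenomena.CardyFormulaZ2.Cruxes.CardyRigidity.CrossingMartingale

/-! ### Definitions: the beta law, the one-sided crossing observables of a driving process -/

/-- The all-rectangle hypothesis of the crux: the bond-`ℤ²` crossing probabilities of every
conformal rectangle converge to `f` of the cross-ratio. [folklore] -/
def AllRectangleKernel (f : ℝ → ℝ) : Prop :=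
  ∀ R : ConformalRectangle, R.HasCrossingLimit (bondDomainCrossingProb R) f

/-- The normalised incomplete beta law `I_a(η) = ∫₀^η (s(1-s))^{-a} ds / ∫₀¹ (s(1-s))^{-a} ds`
(spelled exactly as in `DyadicBetaRigidity.DyadicLatticeBetaLaw`; Cardy's `F` is `I_{2/3}`).
[cite: Cardy1992, eq. (8)] -/
def betaLaw (a : ℝ) (η : ℝ) : ℝ :=
  (∫ s in (0 : ℝ)..η, (s * (1 - s)) ^ (-a)) / ∫ s in (0 : ℝ)..1, (s * (1 - s)) ^ (-a)

section Observables

variable {Ω : Type*}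

/-- The frozen real Loewner flow `X^y_t = g_t(y) - W_t` of the boundary mark `y`, driven by the
path `W ω` (`Loewner.realFlowStop`; `0` from the swallowing time on). [cite: Lawler2005, §4.1] -/
def markFlow (W : Ω → ℝ≥0 → ℝ) (y : ℝ) (t : ℝ≥0) (ω : Ω) : ℝ :=
  Loewner.realFlowStop (W ω) y t

/-- The cross-ratio process of the tip and three marks on one side,
`η_t = X⁰(X² - X¹)/(X¹(X² - X⁰))` (`cardyEta`). [cite: Werner2007, §3] -/
def etaProc (W : Ω → ℝ≥0 → ℝ) (x : Fin 3 → ℝ) (t : ℝ≥0) (ω : Ω) : ℝ :=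
  cardyEta (markFlow W (x 0) t ω) (markFlow W (x 1) t ω) (markFlow W (x 2) t ω)

/-- The level stopping time: first exit of `X⁰` from `(m, M)` or of a gap `X¹ - X⁰`, `X² - X¹`
from `(d, x₂ - x₀ + 1)` (the `W`-generic form of `cardyLevelTime`). [cite: Werner2007, §3] -/
def levelTime (W : Ω → ℝ≥0 → ℝ) (x : Fin 3 → ℝ) (m M d : ℝ) (ω : Ω) : WithTop ℝ≥0 :=
  min (exitTime (markFlow W (x 0)) m M ω)
    (min (exitTime (fun t ω ↦ markFlow W (x 1) t ω - markFlow W (x 0) t ω) d (x 2 - x 0 + 1) ω)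
      (exitTime (fun t ω ↦ markFlow W (x 2) t ω - markFlow W (x 1) t ω) d (x 2 - x 0 + 1) ω))

/-- The level-stopped one-sided crossing observable `f(η_{t ∧ ρ})` of the driving process `W`
with kernel `f`, marks `x` and levels `(m, M, d)`. [cite: Werner2007, §3] -/
def crossingObs (f : ℝ → ℝ) (W : Ω → ℝ≥0 → ℝ) (x : Fin 3 → ℝ) (m M d : ℝ) : ℝ≥0 → Ω → ℝ :=
  stoppedProcess (fun t ω ↦ f (etaProc W x t ω)) (levelTime W x m M d)

/-- Admissible marks `0 < x₀ < x₁ < x₂` and levels `0 < m < x₀ < M`, `0 < d < x₁ - x₀`,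
`d < x₂ - x₁`. [folklore] -/
structure AdmissibleLevels (x : Fin 3 → ℝ) (m M d : ℝ) : Prop where
  strictMono : StrictMono x
  pos : 0 < x 0
  m_pos : 0 < m
  m_lt : m < x 0
  lt_M : x 0 < M
  d_pos : 0 < d
  d_lt₁ : d < x 1 - x 0
  d_lt₂ : d < x 2 - x 1

variable [MeasurableSpace Ω]

/-- A REGULAR driving process on `(Ω, μ)` for the filtration `𝓕`: strongly adapted, continuous
paths, `W 0 = 0`, and for every `t` the running supremum of `|W|` on `[0, t]` is a.s. dominated by
some nonnegative `B ∈ L³(μ)` (the clauses of `LatticeModels.exists_observableMartingale_fkInterface`;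
Kemppainen–Smirnov 2017, Thm 1.3 and Prop. 3.8). [cite: KemppainenSmirnov2017, Thm 1.3] -/
def IsRegularDriver (μ : Measure Ω) (W : Ω → ℝ≥0 → ℝ)
    (𝓕 : Filtration ℝ≥0 ‹MeasurableSpace Ω›) : Prop :=
  StronglyAdapted 𝓕 (fun t ω ↦ W ω t) ∧ (∀ ω, Continuous (W ω)) ∧ (∀ ω, W ω 0 = 0) ∧
    ∀ t : ℝ≥0, ∃ B : Ω → ℝ, MemLp B 3 μ ∧ (∀ ω, 0 ≤ B ω) ∧ ∀ᵐ ω ∂μ, ∀ u, u ≤ t → |W ω u| ≤ B ω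

/-- The CROSSING-MARTINGALE property of `(μ, W, 𝓕)` for the kernel `f`: every level-stopped
one-sided crossing observable is an `𝓕`-martingale under `μ`. [folklore] -/
def IsCrossingMartingaleFamily (f : ℝ → ℝ) (μ : Measure Ω) (W : Ω → ℝ≥0 → ℝ)
    (𝓕 : Filtration ℝ≥0 ‹MeasurableSpace Ω›) : Prop :=
  ∀ (x : Fin 3 → ℝ) (m M d : ℝ), AdmissibleLevels x m M d →
    Martingale (crossingObs f W x m M d) 𝓕 μ

end Observables

/-! ### Lemmas for the composition -/

section Lemmas

variable {Ω : Type*} {W : Ω → ℝ≥0 → ℝ} {x : Fin 3 → ℝ} {m M d : ℝ}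

/-- A continuous path started inside `(a, b)` is in `[a, b]` at every time `≤` its exit time.
[folklore] -/
theorem mem_Icc_of_le_exitTime {u : ℝ≥0 → Ω → ℝ} {a b : ℝ} {ω : Ω}
    (hc : Continuous fun t ↦ u t ω) (h0 : u 0 ω ∈ Ioo a b) {τ : ℝ≥0}
    (hτ : (τ : WithTop ℝ≥0) ≤ exitTime u a b ω) : u τ ω ∈ Icc a b := by
  rw [← Literature.Probability.Process.stoppedProcess_exitTime_eq_of_le hτ]
  exact Literature.Probability.Process.stoppedProcess_exitTime_mem_Icc hc h0 τ

/-- **The stopped moduli live in `(0, 1)`**: for a driving process with continuous paths and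
`W 0 = 0` and admissible marks/levels, `η` at the stopped clock `t ∧ ρ` lies in `(0,1)`.
[cite: Werner2007, §3] -/
theorem etaProc_stopped_mem_Ioo (hWc : ∀ ω, Continuous (W ω)) (hW0 : ∀ ω, W ω 0 = 0)
    (h : AdmissibleLevels x m M d) (t : ℝ≥0) (ω : Ω) :
    etaProc W x (min (t : WithTop ℝ≥0) (levelTime W x m M d ω)).untopA ω ∈ Ioo (0 : ℝ) 1 := by
  set τ : ℝ≥0 := (min (t : WithTop ℝ≥0) (levelTime W x m M d ω)).untopA with hτdef
  have hτρ : (τ : WithTop ℝ≥0) ≤ levelTime W x m M d ω :=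
    Literature.Probability.Process.coe_untopA_min_le t _
  have hx0 : 0 < x 0 := h.pos
  have hx01 : x 0 < x 1 := h.strictMono (by decide)
  have hx12 : x 1 < x 2 := h.strictMono (by decide)
  -- continuity and initial values of the three flows
  have hne : ∀ i : Fin 3, x i ≠ W ω 0 := by
    intro i
    rw [hW0 ω]
    exact (hx0.trans_le (h.strictMono.monotone (Fin.zero_le i))).ne'
  have hcont : ∀ i : Fin 3, Continuous fun s ↦ markFlow W (x i) s ω := fun i ↦
    Loewner.continuous_realFlowStop_of_ne (hWc ω) (hne i)
  have hzero : ∀ i : Fin 3, markFlow W (x i) 0 ω = x i := by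
    intro i
    show Loewner.realFlowStop (W ω) (x i) 0 = x i
    rw [Loewner.realFlowStop_zero_of_ne (hWc ω) (hne i), hW0 ω, sub_zero]
  -- bounds at the stopped clock
  have hX0 : markFlow W (x 0) τ ω ∈ Icc m M := by
    refine mem_Icc_of_le_exitTime (hcont 0) ?_ (hτρ.trans (min_le_left _ _))
    rw [hzero 0]; exact ⟨h.m_lt, h.lt_M⟩
  have hB₁ : x 1 - x 0 < x 2 - x 0 + 1 := by linarith
  have hB₂ : x 2 - x 1 < x 2 - x 0 + 1 := by linarith
  have hg01 : markFlow W (x 1) τ ω - markFlow W (x 0) τ ω ∈ Icc d (x 2 - x 0 + 1) := by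
    refine mem_Icc_of_le_exitTime (u := fun s ω ↦ markFlow W (x 1) s ω - markFlow W (x 0) s ω)
      ((hcont 1).sub (hcont 0)) ?_ (hτρ.trans ((min_le_right _ _).trans (min_le_left _ _)))
    show markFlow W (x 1) 0 ω - markFlow W (x 0) 0 ω ∈ Ioo d (x 2 - x 0 + 1)
    rw [hzero 1, hzero 0]; exact ⟨h.d_lt₁, hB₁⟩
  have hg12 : markFlow W (x 2) τ ω - markFlow W (x 1) τ ω ∈ Icc d (x 2 - x 0 + 1) := by
    refine mem_Icc_of_le_exitTime (u := fun s ω ↦ markFlow W (x 2) s ω - markFlow W (x 1) s ω)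
      ((hcont 2).sub (hcont 1)) ?_ (hτρ.trans ((min_le_right _ _).trans (min_le_right _ _)))
    show markFlow W (x 2) 0 ω - markFlow W (x 1) 0 ω ∈ Ioo d (x 2 - x 0 + 1)
    rw [hzero 2, hzero 1]; exact ⟨h.d_lt₂, hB₂⟩
  have h0 : 0 < markFlow W (x 0) τ ω := h.m_pos.trans_le hX0.1
  have h01 : markFlow W (x 0) τ ω < markFlow W (x 1) τ ω := by linarith [hg01.1, h.d_pos]
  have h12 : markFlow W (x 1) τ ω < markFlow W (x 2) τ ω := by linarith [hg12.1, h.d_pos]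
  exact cardyEta_mem_Ioo h0 h01 h12

/-- **Transfer of the crossing observable along an identity of kernels on `(0,1)`.**
[folklore] -/
theorem crossingObs_congr {f g : ℝ → ℝ} (hfg : EqOn f g (Ioo 0 1))
    (hWc : ∀ ω, Continuous (W ω)) (hW0 : ∀ ω, W ω 0 = 0) (h : AdmissibleLevels x m M d) :
    crossingObs f W x m M d = crossingObs g W x m M d := by
  funext t ω
  exact hfg (etaProc_stopped_mem_Ioo hWc hW0 h t ω)

variable [MeasurableSpace Ω] {μ : Measure Ω} {𝓕 : Filtration ℝ≥0 ‹MeasurableSpace Ω›}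

/-- **Affine change of kernel.** If `f = A·g + B` on `(0,1)` with `A ≠ 0`, a crossing-martingale
family for `f` is one for `g`. [folklore] -/
theorem IsCrossingMartingaleFamily.of_affine [IsFiniteMeasure μ] {f g : ℝ → ℝ} {A B : ℝ}
    (hA : A ≠ 0) (hfg : EqOn f (fun η ↦ A * g η + B) (Ioo 0 1))
    (hreg : IsRegularDriver μ W 𝓕) (hf : IsCrossingMartingaleFamily f μ W 𝓕) :
    IsCrossingMartingaleFamily g μ W 𝓕 := by
  intro x m M d h
  have hWc := hreg.2.1
  have hW0 := hreg.2.2.1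
  -- `g = A⁻¹ (f - B)` on `(0,1)`
  have hgf : EqOn g (fun η ↦ A⁻¹ * f η + (-(A⁻¹ * B))) (Ioo 0 1) := by
    intro η hη
    have := hfg hη
    simp only at this ⊢
    rw [this]
    field_simp
    ring
  rw [crossingObs_congr (W := W) hgf hWc hW0 h]
  have hM : Martingale (crossingObs f W x m M d) 𝓕 μ := hf x m M d h
  have key : crossingObs (fun η ↦ A⁻¹ * f η + -(A⁻¹ * B)) W x m M d =
      A⁻¹ • crossingObs f W x m M d + fun _ _ ↦ -(A⁻¹ * B) := by
    funext t ω
    rfl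
  rw [key]
  exact (hM.smul A⁻¹).add (martingale_const 𝓕 μ _)

end Lemmas

/-! ### The beta law at `a = 2/3` is Cardy's function -/

/-- `I_{2/3} = incBeta13 / incBeta13 1`. [cite: Cardy1992, eq. (8)] -/
theorem betaLaw_two_thirds : ∀ η : ℝ, betaLaw (2 / 3) η = incBeta13 η / incBeta13 1 := by
  intro η
  have hker : (fun s : ℝ ↦ (s * (1 - s)) ^ (-(2 / 3 : ℝ))) = betaKernel13 := by
    funext s; rfl
  simp only [betaLaw, incBeta13, ← hker]

/-- `incBeta13 1 ≠ 0`. [folklore] -/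
theorem incBeta13_one_ne_zero : incBeta13 1 ≠ 0 := by
  intro h
  have := cardyConst_mul_incBeta13_one
  rw [h, mul_zero] at this
  norm_num at this

/-- `I_{2/3}(η) → 0` as `η → 0⁺`. [folklore] -/
theorem tendsto_betaLaw_two_thirds_zero : Tendsto (betaLaw (2 / 3)) (𝓝[>] 0) (𝓝 0) := by
  have hc : ContinuousWithinAt incBeta13 (Icc 0 1) 0 :=
    incBeta13_continuousOn 0 (left_mem_Icc.2 zero_le_one)
  have h0 : incBeta13 0 = 0 := by simp [incBeta13]
  have h1 : Tendsto incBeta13 (𝓝[>] 0) (𝓝 0) := by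
    rw [← nhdsWithin_Ioc_eq_nhdsGT zero_lt_one]
    simpa [h0] using (hc.tendsto.mono_left (nhdsWithin_mono _ Ioc_subset_Icc_self))
  have : Tendsto (fun η ↦ incBeta13 η / incBeta13 1) (𝓝[>] 0) (𝓝 (0 / incBeta13 1)) :=
    h1.div_const _
  simp only [zero_div] at this
  refine this.congr' ?_
  exact Eventually.of_forall fun η ↦ (betaLaw_two_thirds η).symm

/-- `I_{2/3}(η) → 1` as `η → 1⁻`. [folklore] -/
theorem tendsto_betaLaw_two_thirds_one : Tendsto (betaLaw (2 / 3)) (𝓝[<] 1) (𝓝 1) := by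
  have hc : ContinuousWithinAt incBeta13 (Icc 0 1) 1 :=
    incBeta13_continuousOn 1 (right_mem_Icc.2 zero_le_one)
  have h1 : Tendsto incBeta13 (𝓝[<] 1) (𝓝 (incBeta13 1)) := by
    rw [← nhdsWithin_Ico_eq_nhdsLT zero_lt_one]
    exact hc.tendsto.mono_left (nhdsWithin_mono _ Ico_subset_Icc_self)
  have : Tendsto (fun η ↦ incBeta13 η / incBeta13 1) (𝓝[<] 1)
      (𝓝 (incBeta13 1 / incBeta13 1)) := h1.div_const _
  rw [div_self incBeta13_one_ne_zero] at this
  refine this.congr' ?_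
  exact Eventually.of_forall fun η ↦ (betaLaw_two_thirds η).symm

end Summit.CriticalPhenomena.CardyFormulaZ2.Cruxes.CardyRigidity.CrossingMartingale

end
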